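import Summits.BirchSwinnertonDyer.BirchSwinnertonDyer.Theorems.PrintCf2SplitBadTwoH2AboveKilledAtTwo
import HarnessLib

/-!
# Greenberg's (T4) at `p = 2`: weak Leopoldt above `K′K̃_∞` for `K` totally complex and `K′ ∋ i`
# (crux `SplitBadTwoRankOneOfFacts`, stmt-BirchSwinnertonDyer-20368; lane S3n′, by-product)

Cell `bsd-print-cf2`, width seat `bsd-line-cf2-p1-w2` gen 12.  The tree's named fact (T4)
`Greenberg2006.weakLeopoldt_H2_subsingleton_above_cyclotomic_of_isOpen` (= [NQD84] Thm. 2.2 in the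
open-subgroup currency) is typed and PROVED for `p ≠ 2` only; at `p = 2` the printed source carries
«`μ₄ ⊂ k`» ([NQD84] §0; typer ruling bsd-print-cf2-ty2 g33, 2026-08-29T00:44:08Z: the faithful `p = 2`
twin has ONE MORE binder `U₀ ≤ ker χ̄₄`, i.e. `K′ = K̄^{U₀} ∋ i`).  This file PROVES that twin (no
named fact minted): for `K` totally complex, `S ⊇ {v ∣ 2}`, `κ : Fin m → ZpExtension K 2`, `U₀` open
with `N_S ≤ U₀ ≤ ker χ̄₄`, the `χ₂`-torsion clause on `U₀ ∩ ⋂ᵢ ker κᵢ` (`K′K̃_∞ ⊇ K′^{cyc}`) and a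
discrete `D ≃+ ℚ₂/ℤ₂` with the trivial action: `H²(Gal(K_Σ/K′K̃_∞), D) = 0`.  Proof:
`K′K̃_∞ = K′K̃_∞(μ_{2^∞})` (`WeakLeopoldtTwo.mem_iInf_ker_of_mem_torsion_of_mem_ker_four`: torsion
`χ₂` + fixing `μ₄` ⟹ fixing `μ_{2^∞}`) and `WeakLeopoldtTwo.subsingleton_H2_above_tower_muInfty`.

Theorems only; no definition, no named fact, no `sorry`, no instance.  HONEST FRAMING: a theorem of
Iwasawa 1973 / NSW (10.3.25) / NQD84 Thm. 2.2 at `p = 2`; closes nothing by itself (`--supports`).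

References: [NguyenQuangDo1984] §0, Thm. 2.2; [Greenberg2006] pp. 343–344; [NeukirchSchmidtWingberg2008]
(10.3.25); [Washington1997] §13.1.
-/

noncomputable section

open scoped Classical
open NumberField IsDedekindDomain Field
open Literature.NumberTheory.GaloisRepresentations
open Literature.NumberTheory.EllipticCurves (ZpExtension)
open Literature.NumberTheory.IwasawaTheory Literature.NumberTheory.IwasawaTheory.Greenberg2006

set_option linter.dupNamespace false -- `Summit.BirchSwinnertonDyer.BirchSwinnertonDyer` (summit = problem) is the tree's layout

namespace Summit.BirchSwinnertonDyer.BirchSwinnertonDyer.Theorems.PrintCf2.WeakLeopoldtTwo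

/-- **(T4) at `p = 2`** — the body of `Greenberg2006.weakLeopoldt_H2_subsingleton_above_cyclotomic_of_isOpen`
at `p = 2` with `p ≠ 2` replaced by `IsTotallyComplex K` and the printed extra binder `U₀ ≤ ker χ̄₄`
(`K′ ∋ i`, [NQD84] §0 «si p = 2 … k contient les racines quatrièmes de l'unité»): weak Leopoldt
`H²(Gal(K_Σ/K′K̃_∞), D) = 0` above every `ℤ₂^m`-extension `K′K̃_∞ ⊇ K′^{cyc}` of such `K′ ⊆ K_Σ`.
[cite: NguyenQuangDo1984, §0 and Thm. 2.2] [cite: Greenberg2006, pp. 343–344]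
[cite: NeukirchSchmidtWingberg2008, (10.3.25)] -/
theorem weakLeopoldt_H2_subsingleton_above_cyclotomic_of_isOpen_two
    (K : Type) [Field K] [NumberField K] (hK : IsTotallyComplex K)
    (S : Set (HeightOneSpectrum (𝓞 K)))
    (hS : ∀ v : HeightOneSpectrum (𝓞 K), ((2 : ℕ) : 𝓞 K) ∈ v.asIdeal → v ∈ S)
    {m : ℕ} (κ : Fin m → ZpExtension K 2) (U₀ : Subgroup (absoluteGaloisGroup K))
    (hU₀ : IsOpen (U₀ : Set (absoluteGaloisGroup K))) (hN : ramificationSubgroup K S ≤ U₀)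
    (h4 : U₀ ≤ (modNCyclotomicCharacter K (2 ^ 2)).ker)
    (hcyc : ∀ σ : absoluteGaloisGroup K, σ ∈ U₀ ⊓ multiZpKer 2 κ →
      GaloisRep.cyclotomicCharacter K 2 σ ∈ CommGroup.torsion ℤ_[2]ˣ)
    (R : Type) [CommRing R] [TopologicalSpace R] [IsTopologicalRing R]
    (D : Type) [AddCommGroup D] [Module R D] [TopologicalSpace D] [DiscreteTopology D]
    [ContinuousSMul R D] (hD : Nonempty (D ≃+ ℚ_[2] ⧸ (PadicInt.subring 2).toAddSubgroup)) :
    Subsingleton ((ContinuousRep.trivial (galoisGroupAbove S (U₀ ⊓ multiZpKer 2 κ)) R D).H 2) := by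
  have h0 := subsingleton_H2_above_tower_muInfty 2 S (Or.inr hK) hS κ U₀ hU₀ hN (R := R) hD
  have hle : U₀ ⊓ multiZpKer 2 κ ≤ ⨅ k : ℕ, (modNCyclotomicCharacter K (2 ^ k)).ker := fun σ hσ ↦
    mem_iInf_ker_of_mem_torsion_of_mem_ker_four (hcyc σ hσ) (h4 (Subgroup.mem_inf.mp hσ).1)
  exact subsingleton_H2_trivial_congr (congrArg (galoisGroupAbove S) (inf_eq_left.mpr hle)) h0

/-- The same with `U₀` replaced by `U₀ ⊓ ker χ̄₄` INSIDE the statement, so that no hypothesis on `U₀`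
beyond openness and `N_S ≤ U₀` is needed: `H²(Gal(K_Σ/K′(i)K̃_∞), D) = 0`. [cite: NguyenQuangDo1984, Thm. 2.2]
[cite: Greenberg2006, pp. 343–344] -/
theorem weakLeopoldt_H2_subsingleton_above_cyclotomic_adjoin_i_two
    (K : Type) [Field K] [NumberField K] (hK : IsTotallyComplex K)
    (S : Set (HeightOneSpectrum (𝓞 K)))
    (hS : ∀ v : HeightOneSpectrum (𝓞 K), ((2 : ℕ) : 𝓞 K) ∈ v.asIdeal → v ∈ S)
    {m : ℕ} (κ : Fin m → ZpExtension K 2) (U₀ : Subgroup (absoluteGaloisGroup K))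
    (hU₀ : IsOpen (U₀ : Set (absoluteGaloisGroup K))) (hN : ramificationSubgroup K S ≤ U₀)
    (hcyc : ∀ σ : absoluteGaloisGroup K, σ ∈ multiZpKer 2 κ →
      GaloisRep.cyclotomicCharacter K 2 σ ∈ CommGroup.torsion ℤ_[2]ˣ)
    (R : Type) [CommRing R] [TopologicalSpace R] [IsTopologicalRing R]
    (D : Type) [AddCommGroup D] [Module R D] [TopologicalSpace D] [DiscreteTopology D]
    [ContinuousSMul R D] (hD : Nonempty (D ≃+ ℚ_[2] ⧸ (PadicInt.subring 2).toAddSubgroup)) :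
    Subsingleton ((ContinuousRep.trivial (galoisGroupAbove S
      ((U₀ ⊓ (modNCyclotomicCharacter K (2 ^ 2)).ker) ⊓ multiZpKer 2 κ)) R D).H 2) :=
  weakLeopoldt_H2_subsingleton_above_cyclotomic_of_isOpen_two K hK S hS κ _
    (hU₀.inter (isOpen_ker_modNCyclotomicCharacter 2 2))
    (le_inf hN (ramificationSubgroup_le_ker_modNCyclotomicCharacter 2 S hS 2)) inf_le_right
    (fun σ hσ ↦ hcyc σ (Subgroup.mem_inf.mp hσ).2) R D hD

end Summit.BirchSwinnertonDyer.BirchSwinnertonDyer.Theorems.PrintCf2.WeakLeopoldtTwo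

end
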